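import Mathlib
import Literature.NumberTheory.Irrationality.FischlerSprangZudilin2019.Asymptotics
import HarnessLib

/-!
# `g(x₀) < e^{−78}` for `s = 77`, `D = 4` — PROOF of `FischlerSprangZudilin2019.remark3` (Remark 3)

Proofs-only sibling of `FischlerSprangZudilin2019/Asymptotics.lean`: it DISCHARGES the named Literature fact
`Literature.NumberTheory.Irrationality.FischlerSprangZudilin2019.remark3` by `remark3_holds` at the end of the
file; NO new definition, NO new named fact, the statement file is untouched.

What is proved, as printed [cite: FischlerSprangZudilin2019, §4 Remark 3]: "**Remark 3.** For `s = 77` and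
`D = 4` one computes `g(x₀) < exp(−78)`", where (Lemma 3, eq. (4.2))
`g(x) = D^{3D}(x+3)^{3D}(x+1)^{s+1}/(x+2)^{2(s+1)}` and `x₀` is the positive root of
`(X+3)^D(X+1)^{s+1} − X^D(X+2)^{s+1}` — in the tree's rendering (`remark3`): for EVERY real `x₀ > 0` with
`(rootPoly 77 4).eval x₀ = 0` one has `gRate 77 4 x₀ < Real.exp (−78)` (no uniqueness of the root is used or
needed).

The computation is made a kernel certificate (exact rational arithmetic, `norm_num`; no `native_decide`):
* ROOT ENCLOSURE `x₀ ≤ δ := 43·10⁻⁷`: for `x > δ`, `((x+3)/x)^4 < ((x+2)/(x+1))^78` — on `(δ, 1/200]`,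
  `[1/200, 3/2]`, `[3/2, 16]` by the monotone endpoint bounds `(x+3)/x ≤ (lo+3)/lo`, `(x+2)/(x+1) ≥ (hi+2)/(hi+1)`
  and three rational comparisons; on `[16, ∞)` by `(1+3/x)^4 ≤ 1 + (3/x)·4·(19/16)^3 < 1 + 78/(x+1) ≤ (1+1/(x+1))^78`
  (Bernoulli) — hence `(x+3)^4(x+1)^78 < x^4(x+2)^78`, so `x` is not a root (the true root is `x₀ ≈ 4.046·10⁻⁶`);
* AT A ROOT, `(x+1)^78 = x^4(x+2)^78/(x+3)^4`, so `g(x₀) = 4¹² x₀⁴ (x₀+3)⁸/(x₀+2)^78 ≤ 4¹² δ⁴ (δ+3)⁸/2^78`;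
* `4¹² δ⁴ (δ+3)⁸/2^78 < 2.7182818286^{−78} < e^{−78}` (`Real.exp_one_lt_d9`; the exact value of the left side
  times `2.7182818286^78` is `0.9336…`).
HONEST FRAMING (cells pub-zeta5 / zeta5-irr): a numerical remark of the source as a kernel inequality; the
source's consequence (two of `ζ(5),…,ζ(77)` irrational, via Lemmas 1–4) is neither restated nor claimed here.
Reference: [FischlerSprangZudilin2019] S. Fischler, J. Sprang, W. Zudilin, *Many odd zeta values are
irrational*, Compositio Math. 155 (2019) 938–952 = arXiv:1803.08905, §4 Remark 3 (held text
`paper:arxiv-1803.08905`).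
-/

noncomputable section

namespace Literature.NumberTheory.Irrationality.FischlerSprangZudilin2019

/-! ### The root enclosure `x₀ ≤ 43·10⁻⁷` -/

/-- Reduction of `(x+3)^4(x+1)^78 < x^4(x+2)^78` (`x > 0`) to the comparison of the two ratios
`((x+3)/x)^4 < ((x+2)/(x+1))^78`. [folklore] -/
private theorem poly_lt_of_ratio_lt {x : ℝ} (hx : 0 < x)
    (h : ((x + 3) / x) ^ 4 < ((x + 2) / (x + 1)) ^ 78) :
    (x + 3) ^ 4 * (x + 1) ^ 78 < x ^ 4 * (x + 2) ^ 78 := by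
  have hx1 : 0 < x + 1 := by linarith
  have hA : x + 3 = (x + 3) / x * x := by field_simp
  have hB : x + 2 = (x + 2) / (x + 1) * (x + 1) := by field_simp
  rw [hA, hB, mul_pow, mul_pow]
  have hpos : 0 < x ^ 4 * (x + 1) ^ 78 := by positivity
  calc ((x + 3) / x) ^ 4 * x ^ 4 * (x + 1) ^ 78
      = ((x + 3) / x) ^ 4 * (x ^ 4 * (x + 1) ^ 78) := by ring
    _ < ((x + 2) / (x + 1)) ^ 78 * (x ^ 4 * (x + 1) ^ 78) := mul_lt_mul_of_pos_right h hpos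
    _ = x ^ 4 * (((x + 2) / (x + 1)) ^ 78 * (x + 1) ^ 78) := by ring

/-- On a range `lo ≤ x ≤ hi` (`lo > 0`) the ratio comparison follows from the endpoint comparison
`((lo+3)/lo)^4 < ((hi+2)/(hi+1))^78`, both ratios being decreasing in `x`. [folklore] -/
private theorem ratio_lt_of_mem_range {x lo hi : ℝ} (hlo : 0 < lo) (hlx : lo ≤ x) (hxh : x ≤ hi)
    (hnum : ((lo + 3) / lo) ^ 4 < ((hi + 2) / (hi + 1)) ^ 78) :
    ((x + 3) / x) ^ 4 < ((x + 2) / (x + 1)) ^ 78 := by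
  have hx : 0 < x := lt_of_lt_of_le hlo hlx
  have h1 : (x + 3) / x ≤ (lo + 3) / lo := by
    rw [div_le_div_iff₀ hx hlo]
    nlinarith
  have h2 : (hi + 2) / (hi + 1) ≤ (x + 2) / (x + 1) := by
    rw [div_le_div_iff₀ (by linarith) (by linarith)]
    nlinarith
  have h1' : 0 ≤ (x + 3) / x := by positivity
  have h2' : 0 ≤ (hi + 2) / (hi + 1) := div_nonneg (by linarith) (by linarith)
  calc ((x + 3) / x) ^ 4 ≤ ((lo + 3) / lo) ^ 4 := pow_le_pow_left₀ h1' h1 4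
    _ < ((hi + 2) / (hi + 1)) ^ 78 := hnum
    _ ≤ ((x + 2) / (x + 1)) ^ 78 := pow_le_pow_left₀ h2' h2 78

/-- On `[16, ∞)` the ratio comparison follows from Bernoulli's inequality:
`(1+3/x)^4 ≤ 1 + (3/x)·4·(19/16)^3 < 1 + 78/(x+1) ≤ (1+1/(x+1))^78`. [folklore] -/
private theorem ratio_lt_of_ge_sixteen {x : ℝ} (hx : 16 ≤ x) :
    ((x + 3) / x) ^ 4 < ((x + 2) / (x + 1)) ^ 78 := by
  have hx0 : 0 < x := by linarith
  have hx1 : 0 < x + 1 := by linarith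
  set a : ℝ := 3 / x with ha
  set b : ℝ := 1 / (x + 1) with hb
  have hA : (x + 3) / x = 1 + a := by rw [ha]; field_simp
  have hB : (x + 2) / (x + 1) = 1 + b := by rw [hb]; field_simp; ring
  have ha0 : 0 ≤ a := by positivity
  have ha1 : a ≤ 3 / 16 := by
    rw [ha, div_le_div_iff₀ hx0 (by norm_num)]
    linarith
  -- `(1+a)^4 ≤ 1 + 4a(1+a)^3 ≤ 1 + 4a(19/16)^3`
  have h4 : (1 + a) ^ 4 ≤ 1 + 4 * a * (19 / 16) ^ 3 := by
    have h19 : 1 + a ≤ 19 / 16 := by linarith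
    have hcube : (1 + a) ^ 3 ≤ (19 / 16) ^ 3 := pow_le_pow_left₀ (by linarith) h19 3
    nlinarith [hcube, pow_nonneg ha0 2, pow_nonneg ha0 3, pow_nonneg ha0 4]
  -- `4a(19/16)^3 < 78 b`
  have hab : 4 * a * (19 / 16) ^ 3 < 78 * b := by
    rw [ha, hb]
    rw [show 4 * (3 / x) * (19 / 16 : ℝ) ^ 3 = 82308 / 4096 / x by ring,
      show (78 : ℝ) * (1 / (x + 1)) = 78 / (x + 1) by ring,
      div_lt_div_iff₀ hx0 hx1]
    nlinarith
  -- Bernoulli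
  have hb0 : 0 ≤ b := by positivity
  have hbern : 1 + 78 * b ≤ (1 + b) ^ 78 := by
    have := one_add_mul_le_pow (show (-2 : ℝ) ≤ b by linarith) 78
    norm_num at this
    linarith
  rw [hA, hB]
  linarith

/-- **Root enclosure**: every positive root of `(X+3)^4(X+1)^78 − X^4(X+2)^78` satisfies `x₀ ≤ 43·10⁻⁷`.
[cite: FischlerSprangZudilin2019, §4 Remark 3 (the computation, root location)] -/
theorem root_le_of_eval_rootPoly_eq_zero {x : ℝ} (hx : 0 < x) (hroot : (rootPoly 77 4).eval x = 0) :
    x ≤ 43 / 10 ^ 7 := by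
  by_contra hlt
  have hlt : (43 : ℝ) / 10 ^ 7 < x := lt_of_not_ge hlt
  have hratio : ((x + 3) / x) ^ 4 < ((x + 2) / (x + 1)) ^ 78 := by
    rcases le_or_gt x (1 / 200) with h1 | h1
    · exact ratio_lt_of_mem_range (lo := 43 / 10 ^ 7) (hi := 1 / 200) (by norm_num) hlt.le h1 (by norm_num)
    rcases le_or_gt x (3 / 2) with h2 | h2
    · exact ratio_lt_of_mem_range (lo := 1 / 200) (hi := 3 / 2) (by norm_num) h1.le h2 (by norm_num)
    rcases le_or_gt x 16 with h3 | h3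
    · exact ratio_lt_of_mem_range (lo := 3 / 2) (hi := 16) (by norm_num) h2.le h3 (by norm_num)
    · exact ratio_lt_of_ge_sixteen h3.le
  have hlt' := poly_lt_of_ratio_lt hx hratio
  rw [eval_rootPoly] at hroot
  norm_num at hroot
  linarith

/-! ### The value of `g` at a root and the final bound -/

/-- **At a root**, `g(x₀) = 4¹² x₀⁴ (x₀+3)⁸/(x₀+2)^78` (substitute `(x+1)^78 = x^4(x+2)^78/(x+3)^4` into (4.2)).
[cite: FischlerSprangZudilin2019, §4 Remark 3 (the computation, value of g at the root)] -/
theorem gRate_eq_of_eval_rootPoly_eq_zero {x : ℝ} (hx : 0 < x) (hroot : (rootPoly 77 4).eval x = 0) :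
    gRate 77 4 x = 4 ^ 12 * x ^ 4 * (x + 3) ^ 8 / (x + 2) ^ 78 := by
  rw [eval_rootPoly] at hroot
  have hroot' : (x + 3) ^ 4 * (x + 1) ^ 78 = x ^ 4 * (x + 2) ^ 78 := by
    norm_num at hroot
    linarith
  unfold gRate
  norm_num
  rw [div_eq_div_iff (by positivity) (by positivity)]
  generalize hu : x + 1 = u at hroot' ⊢
  generalize hv : x + 2 = v at hroot' ⊢
  generalize hw : x + 3 = w at hroot' ⊢
  linear_combination (16777216 * w ^ 8 * v ^ 78) * hroot'

/-- The numerical heart: `4¹² δ⁴ (δ+3)⁸/2^78 < e^{−78}` for `δ = 43·10⁻⁷` (via `e < 2.7182818286`).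
[cite: FischlerSprangZudilin2019, §4 Remark 3 (the computation, final inequality)] -/
theorem bound_lt_exp_neg : (4 : ℝ) ^ 12 * (43 / 10 ^ 7) ^ 4 * (43 / 10 ^ 7 + 3) ^ 8 / 2 ^ 78 < Real.exp (-78) := by
  have he : Real.exp (-78) = (Real.exp 1 ^ 78)⁻¹ := by
    rw [Real.exp_one_pow, ← Real.exp_neg]
    norm_num
  rw [he]
  have hlt : Real.exp 1 ^ 78 < (2.7182818286 : ℝ) ^ 78 :=
    pow_lt_pow_left₀ Real.exp_one_lt_d9 (Real.exp_pos 1).le (by norm_num)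
  have hpos : 0 < Real.exp 1 ^ 78 := pow_pos (Real.exp_pos 1) 78
  calc (4 : ℝ) ^ 12 * (43 / 10 ^ 7) ^ 4 * (43 / 10 ^ 7 + 3) ^ 8 / 2 ^ 78
      < ((2.7182818286 : ℝ) ^ 78)⁻¹ := by
        rw [lt_inv_comm₀ (by positivity) (by positivity)]
        norm_num
    _ < (Real.exp 1 ^ 78)⁻¹ := by
        rw [inv_lt_inv₀ (by positivity) hpos]
        exact hlt

/-- **Fischler–Sprang–Zudilin 2019, Remark 3 — PROVED**: for `s = 77`, `D = 4`, every positive root `x₀` of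
`(X+3)^4(X+1)^78 − X^4(X+2)^78` has `g(x₀) < e^{−78}`; i.e. the named fact `remark3` holds.
[cite: FischlerSprangZudilin2019, §4 Remark 3] -/
theorem remark3_holds : remark3 := by
  intro x hx hroot
  have hxle := root_le_of_eval_rootPoly_eq_zero hx hroot
  rw [gRate_eq_of_eval_rootPoly_eq_zero hx hroot]
  have hx2 : (2 : ℝ) ≤ x + 2 := by linarith
  calc (4 : ℝ) ^ 12 * x ^ 4 * (x + 3) ^ 8 / (x + 2) ^ 78
      ≤ 4 ^ 12 * (43 / 10 ^ 7) ^ 4 * (43 / 10 ^ 7 + 3) ^ 8 / 2 ^ 78 := by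
        gcongr
    _ < Real.exp (-78) := bound_lt_exp_neg

end Literature.NumberTheory.Irrationality.FischlerSprangZudilin2019
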